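import Literature.NumberTheory.EllipticCurves.CongruenceVisibilityLocalFactors
import Literature.NumberTheory.EllipticCurves.MordellWeilModNCard
import Literature.NumberTheory.EllipticCurves.Rank1Residual.Typed.KolyvaginCertificate
import Literature.NumberTheory.EllipticCurves.Rank1Residual.Typed.CasselsLowerBound
import Literature.NumberTheory.EllipticCurves.BSDSelmerCMPConverseRankOneProofs
import Literature.NumberTheory.EllipticCurves.NonEisensteinPrimeOfSurjective
import Summits.BirchSwinnertonDyer.Rank1Residual.Partition.Rows
import HarnessLib

/-!
# BSD rank-≤1 residual cell, class X11b: `BSD(E,p)` at a RANK-ONE pair with `p² ‖ #Ш_an` from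
# Kolyvagin's index bound (upper half) and a VISIBLE `Ш(E)[p] ≠ 0` (lower half, Cassels–Tate)

HONEST FRAMING (cell `b2b-bsdres-*`, run/shared/lean/b2b/bsd-rank1-residual/, verbatim): the goal
of the cell is to DELETE the COMBINATION-SHAPED residual classes for ALL analytic-rank `≤ 1` elliptic
curves over `ℚ` — "full BSD formula for every rank `≤ 1` curve in class C" assembled STRICTLY from
published theorems — so that the rank-`≤ 1` remainder becomes exactly the CONSTRUCTION-SHAPED
classes, which are TYPED (missing-input Props), NOT attempted; this is not "finishing BSD".
Prove what is provable now; shrink each hard class to its core with data; no claim beyond stated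
classes. Research route of unit `b2b-bsdres-x11c` (gen 4); class X11b stays CONSTRUCTION-SHAPED; this
file is PER PAIR (a certificate shape), not a class theorem; no named fact is introduced (theorems
only).

## What this file does

The rank-ONE companion of x11a's `Typed/X11Visibility.lean` (rank `0`: Wuthrich's upper bound +
Cassels–Tate + a visible element). At a pair `(E, p)` with `ord_{s=1} L(E,s) = 1`, `ρ̄_{E,p}` onto
`GL₂(𝔽_p)` and `#Ш(E/ℚ)_an = s`, `ord_p s = 2`:

* UPPER half `ord_p #Ш(E/ℚ) ≤ 2` from Kolyvagin's bound `ord_p #Ш(E/K) ≤ 2·ord_p [E(K) : ℤ y_K]`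
  (tree NAMED FACTS `kolyvagin` — finiteness of `Ш(E/K)`, rank one — and
  `Kolyvagin1990_padicValNat_card_sha_le`, McCallum 1991 §1 / Gross 1991 Thm. 1.3, both PUBLISHED)
  at a Heegner datum with `ord_p [E(K) : ℤ y_K] ≤ 1`, and the injectivity of restriction
  `Ш(E/ℚ) → Ш(E/K)` on the `p`-primary part for `p` odd (`[K:ℚ] = 2`; tree theorem
  `injOn_shaRestriction_torsionBy`, Serre *Galois Cohomology* I.§2.4) — this file's
  `padicValNat_shaOrder_le_baseChange` and `padicValNat_shaOrder_le_of_kolyvagin`;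
* LOWER half `ord_p #Ш(E/ℚ) ≥ 2` from ONE non-zero element of `Ш(E/ℚ)[p]` (Cassels–Tate squareness,
  tree named fact `exists_casselsTate_pairing`, bsd.S18, PUBLISHED; `Typed/CasselsLowerBound.lean`)
  SUPPLIED by the KERNEL visibility theorem `WeierstrassCurve.exists_sha_ne_zero_of_congr`
  (`CongruenceVisibility*.lean`: the dimension count of Cremona–Mazur 2000 §3 / Agashe–Stein 2002
  Thm. 3.1, valid at `p ∣ N`) from a `Γ_ℚ`-isomorphism `θ : E'[p] ≅ E[p]` with a curve `E'` of rank
  `≥ rank E + 2 = 3` — this file's `exists_sha_ne_zero_of_congr_of_rank_add` (the count for `E` of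
  ANY rank: `[E(K):pE(K)] = p^{rank}·#E(K)[p]`, tree theorem `natCard_quotient_nsmulRange_point_eq`,
  so `p^{rank E} · p^{[K:ℚ]} < p^{rank E'}` suffices when `E(K)[p] = 0` and `E'(K_v)[p] = 0` on `S`);
* the two halves give Miller's `BSD(E,p)` (`bsdp_of_kolyvagin_of_congr`; class shape
  `ClassX11b.bsdp_of_kolyvagin_of_congr`).

Where it bites (numbers, not adjectives; HOME/b2b-bsdres-x11c/REPORT.md §13): the unit's list-B pair
`403280bd1@5` (`N = 2⁴·5·71²`, non-split multiplicative at `5`, `ρ̄_{E,5}` onto, no (ram) prime,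
`#Ш_an = 25`, `∏ c_q = 2`), the only X11 ∧ `r = 1` ∧ ¬sst pair with `5 ∣ #Ш_an` below `5·10⁵`:
partner `E' = 403280a1` (Cremona rank `3`, `a_ℓ(E) ≡ a_ℓ(E') (mod 5)` for all `ℓ` up to the Sturm
bound `122688`, two engines), Heegner field `ℚ(√-31)` with `m = 40`, `ord₅ m = 1` (two engines, gen 3).
Per-pair file: `X11b/VisibilityPair403280bd1.lean`.

References: Cremona–Mazur 2000 §3 [CremonaMazur2000]; Agashe–Stein 2002 Thm. 3.1 [AgasheStein2002];
McCallum 1991 §1 [McCallumLMS1991]; Gross 1991 Thm. 1.3 [GrossLMS1991]; Silverman AEC X.4.14,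
VIII.6.7 [SilvermanAEC2009]; Serre, *Galois Cohomology* I.§2.4 [SerreGaloisCohomology1997]; Miller
2011 Def. 1.1 [Miller2011LMS]; Mazur 1977 III.§5 [Mazur1977]; cell files `Typed/X11Visibility.lean`,
`Typed/KolyvaginCertificate.lean`, `Typed/CasselsLowerBound.lean`.
-/

noncomputable section

open scoped Classical

open WeierstrassCurve Literature.NumberTheory.EllipticCurves
  Literature.NumberTheory.EllipticCurves.Rank1Residual
  Literature.NumberTheory.EllipticCurves.Rank1Residual.Typed
open NumberField IsDedekindDomain

namespace Summit.BirchSwinnertonDyer.Rank1Residual.X11b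

universe u

/-! ### §1. `[E(K) : pE(K)] = p^{rank} · #E(K)[p]` and the visibility count for `E` of any rank -/

section Count

variable {K : Type} [Field K] [NumberField K] (W W' : WeierstrassCurve K) [W.IsElliptic]
  [W'.IsElliptic] {p : ℕ} [Fact p.Prime]

omit [W'.IsElliptic] [Fact p.Prime] in
/-- **`[E(K) : nE(K)] = n ^ rank E(K) · #E(K)[n]`** (`n ≥ 1`) in the `zsmulAddGroupHom`-index form
used by the visibility count (tree theorem `natCard_quotient_nsmulRange_point_eq`: Mordell–Weil and
the descent count, Silverman AEC VIII.§1 / X.1). [cite: SilvermanAEC2009, Thm. VIII.6.7 and Prop. X.1.4] -/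
theorem index_range_zsmul_eq_pow_rank_mul_card_torsionBy {n : ℕ} (hn : n ≠ 0) :
    (zsmulAddGroupHom (n : ℤ) : W.toAffine.Point →+ W.toAffine.Point).range.index =
      n ^ W.mordellWeilRank * Nat.card (AddSubgroup.torsionBy W.toAffine.Point (n : ℤ)) := by
  haveI : NeZero n := ⟨hn⟩
  have hrange : (zsmulAddGroupHom (n : ℤ) : W.toAffine.Point →+ W.toAffine.Point).range =
      (nsmulAddMonoidHom n : W.toAffine.Point →+ W.toAffine.Point).range := by
    ext x
    simp only [AddMonoidHom.mem_range, zsmulAddGroupHom_apply, nsmulAddMonoidHom_apply,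
      natCast_zsmul]
  rw [hrange, AddSubgroup.index]
  exact natCard_quotient_nsmulRange_point_eq W n

/-- **Visible `Ш(E/K)[p] ≠ 0` from a `p`-congruent curve of rank `≥ rank E(K) + [K:ℚ] + 1`, for `E`
of ANY rank** (over `ℚ`: rank `E' ≥ rank E + 2`). Hypotheses: `p` odd, `θ : E'[p] ≅ E[p]`
`Γ_K`-equivariant, `S` a finite set of finite places outside which `E, E'` have good reduction and
which contains the places above `p`, `E(K)[p] = 0` (`#E(K)[p] = 1`), `E'(K_v)[p] = 0` for `v ∈ S`.
Then `[E(K):pE(K)] · ∏_{v ∈ S} #E'(K_v)[p] · p^{[K:ℚ]} = p^{rank E} · p^{[K:ℚ]} < p^{rank E'} ≤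
[E'(K):pE'(K)]`, so the KERNEL dimension count `exists_sha_ne_zero_of_congr` (Cremona–Mazur /
Agashe–Stein, no condition at `p`) applies. [cite: CremonaMazur2000, §3 pp. 19–22]
[cite: AgasheStein2002, Lemma 3.6 and Thm. 3.1] -/
theorem exists_sha_ne_zero_of_congr_of_rank_add (hp2 : p ≠ 2)
    (θ : geomTorsion W' (p : ℤ) ≃+ geomTorsion W (p : ℤ))
    (hθ : ∀ (σ : Field.absoluteGaloisGroup K) (P : geomTorsion W' (p : ℤ)), θ (σ • P) = σ • θ P)
    (S : Finset (HeightOneSpectrum (𝓞 K)))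
    (hS : ∀ v : HeightOneSpectrum (𝓞 K), v ∉ S →
      W.HasGoodReductionAt v ∧ W'.HasGoodReductionAt v ∧ (p : 𝓞 K) ∉ v.asIdeal)
    (htors : Nat.card (AddSubgroup.torsionBy W.toAffine.Point (p : ℤ)) = 1)
    (hrank : W.mordellWeilRank + Module.finrank ℚ K + 1 ≤ W'.mordellWeilRank)
    (hloc : ∀ v ∈ S, Nat.card (nsmulAddMonoidHom p :
      (W'.baseChange (v.adicCompletion K)).toAffine.Point →+ _).ker = 1) :
    ∃ c : W.sha, c ≠ 0 ∧ p • c = 0 := by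
  have hp : p.Prime := Fact.out
  refine exists_sha_ne_zero_of_congr W W' hp2 θ hθ S hS ?_
  rw [index_range_zsmul_eq_pow_rank_mul_card_torsionBy W hp.ne_zero, htors, mul_one,
    Finset.prod_eq_one hloc, mul_one, ← pow_add]
  calc p ^ (W.mordellWeilRank + Module.finrank ℚ K)
      < p ^ (W.mordellWeilRank + Module.finrank ℚ K + 1) :=
        Nat.pow_lt_pow_right hp.one_lt (Nat.lt_succ_self _)
    _ ≤ p ^ W'.mordellWeilRank := Nat.pow_le_pow_right hp.pos hrank
    _ ≤ _ := pow_mordellWeilRank_le_index_range_zsmul W' hp.ne_zero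

end Count

/-! ### §2. `ord_p #Ш(E/ℚ) ≤ ord_p #Ш(E/K)` for `p ∤ [K:ℚ]`, and Kolyvagin's upper half -/

section Upper

variable (W : WeierstrassCurve ℚ) [W.IsElliptic] (p : ℕ) [Fact p.Prime]

omit [W.IsElliptic] in
/-- **`ord_p #Ш(E/ℚ) ≤ ord_p #Ш(E/K)`** for a Galois number field `K` with `p ∤ [K : ℚ]` and both
groups finite: restriction `Ш(E/ℚ) → Ш(E/K)` is injective on `Ш(E/ℚ)[p^a]` (tree theorem
`injOn_shaRestriction_torsionBy`, Serre *Galois Cohomology* I.§2.4: `cor ∘ res = [K:ℚ]`), hence on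
the `p`-primary component (of order `p^{ord_p #Ш(E/ℚ)}`, a Sylow subgroup), whose image is a subgroup
of `Ш(E/K)` of that order. [cite: SerreGaloisCohomology1997, I.§2.4 Cor. to Prop. 9] -/
theorem padicValNat_shaOrder_le_baseChange (K : Type) [Field K] [NumberField K] [IsGalois ℚ K]
    (hcop : p.Coprime (Module.finrank ℚ K)) (hfin : W.ShaFinite)
    (hfinK : (W.baseChange K).ShaFinite) :
    padicValNat p W.shaOrder ≤ padicValNat p (W.baseChange K).shaOrder := by
  have hp : p.Prime := Fact.out
  haveI : Finite W.sha := hfin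
  haveI : Finite (W.baseChange K).sha := hfinK
  set a := padicValNat p W.shaOrder with ha
  set Pp : AddSubgroup W.sha := AddCommGroup.primaryComponent W.sha p with hPp
  have hcardP : Nat.card Pp = p ^ a := by
    rw [hPp, card_addPrimaryComponent_eq_pow, ha, WeierstrassCurve.shaOrder,
      Nat.factorization_def _ hp]
  -- every element of the `p`-primary component is killed by `p ^ a`
  have hmem : ∀ x : W.sha, x ∈ Pp →
      x ∈ (AddSubgroup.torsionBy W.sha ((p ^ a : ℕ) : ℤ) : Set W.sha) := by
    intro x hx
    rw [SetLike.mem_coe, AddSubgroup.torsionBy.nsmul_iff]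
    have hdvd : addOrderOf (⟨x, hx⟩ : Pp) ∣ p ^ a := hcardP ▸ addOrderOf_dvd_natCard _
    have h0 : (p ^ a) • (⟨x, hx⟩ : Pp) = 0 := addOrderOf_dvd_iff_nsmul_eq_zero.mp hdvd
    have h1 := congrArg Subtype.val h0
    simpa using h1
  -- restriction is injective on the `p`-primary component
  have hcopa : (p ^ a).Coprime (Module.finrank ℚ K) := Nat.Coprime.pow_left a hcop
  set f : Pp →+ (W.baseChange K).sha := (shaRestriction W K).comp Pp.subtype with hf
  have hinj : Function.Injective f := by
    intro x y hxy
    apply Subtype.ext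
    exact injOn_shaRestriction_torsionBy W K hcopa (hmem x.1 x.2) (hmem y.1 y.2) hxy
  have hdvd : p ^ a ∣ (W.baseChange K).shaOrder := by
    rw [← hcardP, WeierstrassCurve.shaOrder]
    exact AddSubgroup.card_dvd_of_injective f hinj
  have hne : (W.baseChange K).shaOrder ≠ 0 := (WeierstrassCurve.shaOrder_pos _ hfinK).ne'
  exact (padicValNat_dvd_iff_le hne).mp hdvd

/-- **Kolyvagin's upper half at a rank-one pair: `ord_p #Ш(E/ℚ) ≤ 2k` from a Heegner datum with
`ord_p [E(K) : ℤ y_K] ≤ k`.** PUBLISHED named facts: `kolyvagin` (`hKo`: `Ш(E/K)` finite, Kolyvagin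
1990 Thm. A) and `Kolyvagin1990_padicValNat_card_sha_le` (`hB`: McCallum 1991 §1 / Gross 1991
Thm. 1.3 (2), `ord_p #Ш(E/K) ≤ 2·ord_p [E(K) : ℤ y_K]` for `p` odd with `ρ̄_{E,p}` onto `GL₂(𝔽_p)`);
`Ш(E/ℚ)` finite (`hfin`, e.g. by Gross–Zagier–Kolyvagin); `[K:ℚ] = 2` is prime to `p`
(`padicValNat_shaOrder_le_baseChange`). [cite: McCallumLMS1991, §1 Theorem (Kolyvagin), p. 296]
[cite: GrossLMS1991, §1 Thm. 1.3 (2), p. 236] [cite: SerreGaloisCohomology1997, I.§2.4] -/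
theorem padicValNat_shaOrder_le_of_kolyvagin {N : ℕ} [NeZero N] {K : Type} [Field K]
    [NumberField K] (hKo : kolyvagin N W K) (hB : Kolyvagin1990_padicValNat_card_sha_le N W K)
    (hK : IsImaginaryQuadratic K) (hH : SatisfiesHeegnerHypothesis N K)
    {P : (W.baseChange K).toAffine.Point} (hP : IsHeegnerPoint N W K P) (hnt : ¬ IsOfFinAddOrder P)
    (hp2 : p ≠ 2) (hρ : W.HasSurjectiveModNGaloisRep p) (hfin : W.ShaFinite) {k : ℕ}
    (hI : padicValNat p (AddSubgroup.zmultiples P).index ≤ k) :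
    padicValNat p W.shaOrder ≤ 2 * k := by
  have hp : p.Prime := Fact.out
  obtain ⟨-, hfinK⟩ := hKo hK hH hP hnt
  haveI : IsGalois ℚ K := by
    haveI : Algebra.IsQuadraticExtension ℚ K := ⟨hK.1⟩
    infer_instance
  have hcop : p.Coprime (Module.finrank ℚ K) := by
    rw [hK.1]
    exact (Nat.coprime_primes hp Nat.prime_two).mpr hp2
  calc padicValNat p W.shaOrder ≤ padicValNat p (W.baseChange K).shaOrder :=
        padicValNat_shaOrder_le_baseChange W p K hcop hfin hfinK
    _ ≤ 2 * padicValNat p (AddSubgroup.zmultiples P).index := hB hK hH hP hnt hp hp2 hρ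
    _ ≤ 2 * k := Nat.mul_le_mul_left 2 hI

omit [W.IsElliptic] [Fact p.Prime] in
/-- **The typed UPPER half** (`MissingUpperBoundAt`: `ord_p #Ш ≤ ord_p #Ш_an`) at a pair with
`#Ш_an = s`, `2k ≤ ord_p s`, from `ord_p #Ш(E/ℚ) ≤ 2k`. Bookkeeping. [cite: Miller2011LMS, Def. 1.1] -/
theorem missingUpperBoundAt_of_padicValNat_shaOrder_le {k : ℕ} (hle : padicValNat p W.shaOrder ≤ 2 * k)
    {s : ℚ} (hs : shaAn W = (s : ℂ)) (hv : (2 * k : ℤ) ≤ padicValRat p s) : MissingUpperBoundAt W p :=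
  ⟨s, hs, le_trans (by exact_mod_cast hle) hv⟩

end Upper

/-! ### §3. `BSD(E,p)` at a rank-one pair with `ord_p #Ш_an = 2`: Kolyvagin + visibility -/

/-- `#E(ℚ)[n]` does not depend on the `DecidableEq ℚ` instance used by Mathlib's group law on affine
points (`DecidableEq ℚ` is a subsingleton): the tree's lemmas over a general number field carry the
classical instance, its `ℚ`-lemmas the computable one (cf. `Rank1Residual.addOrderOf_point_eq_of_subsingleton`).
[folklore] -/
theorem natCard_torsionBy_point_eq_of_subsingleton (W : WeierstrassCurve ℚ) (d₁ d₂ : DecidableEq ℚ)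
    (n : ℤ) :
    Nat.card (@AddSubgroup.torsionBy W.toAffine.Point
        (@WeierstrassCurve.Affine.Point.instAddCommGroup ℚ _ W.toAffine d₁) n) =
      Nat.card (@AddSubgroup.torsionBy W.toAffine.Point
        (@WeierstrassCurve.Affine.Point.instAddCommGroup ℚ _ W.toAffine d₂) n) := by
  obtain rfl : d₁ = d₂ := Subsingleton.elim _ _
  rfl

section Assembly

variable (W : WeierstrassCurve ℚ) [W.IsElliptic] (p : ℕ) [Fact p.Prime]

/-- **Rank one, odd `p`, `ρ̄_{E,p}` onto, `ord_p #Ш_an = 2`: `BSD(E,p)` from PUBLISHED theorems plus TWO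
per-pair certificates — Kolyvagin's Heegner datum with `ord_p [E(K) : ℤ y_K] ≤ 1` (UPPER half) and a
`p`-CONGRUENT CURVE OF RANK `≥ 3` (LOWER half, visibility + Cassels–Tate).** Published binders:
`kolyvagin` (`hKo`), `Kolyvagin1990_padicValNat_card_sha_le` (`hB`), Cassels–Tate (`hCT`, bsd.S18),
Gross–Zagier–Kolyvagin (`hGZK`, bsd.S17: `rank E(ℚ) = r_an = 1`, `Ш(E/ℚ)` finite). Per-pair data
(explicit binders, finite computations about DEFINED objects): the Heegner field `K` with the Heegner
hypothesis for the level `N`, the Heegner point `P` of infinite order and `ord_p [E(K) : ℤ P] ≤ 1`;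
the partner `E' = W'` with a `Γ_ℚ`-equivariant `θ : E'[p] ≃ E[p]` (certified by a Sturm-bound
congruence of two newforms of the same level plus irreducibility of `E[p]`: Cremona–Mazur 2000
p. 21), `rank E'(ℚ) ≥ 3`, a finite set `S` (outside: good reduction of both and `v ∤ p`) with
`E'(ℚ_v)[p] = 0` for `v ∈ S`; `#Ш_an = s` with `ord_p s = 2`. Then `ord_p #Ш(E/ℚ) = 2 = ord_p s`.
`E(ℚ)[p] = 0` is automatic (surjective ⇒ irreducible ⇒ no rational `p`-torsion, Mazur). NOT a class
theorem (per-pair partner data); no label changes; the lane certifies.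
[cite: McCallumLMS1991, §1 Theorem (Kolyvagin), p. 296] [cite: SilvermanAEC2009, Thm. X.4.14]
[cite: CremonaMazur2000, §3 and Table 1] [cite: AgasheStein2002, Thm. 3.1]
[cite: Miller2011LMS, §1 and Def. 1.1] [cite: Mazur1977, Ch. III §5, p. 157] -/
theorem bsdp_of_kolyvagin_of_congr (hCT : exists_casselsTate_pairing (K := ℚ))
    (hGZK : rank_eq_analyticRank_of_analyticRank_le_one)
    {N : ℕ} [NeZero N] {K : Type} [Field K] [NumberField K] (hKo : kolyvagin N W K)
    (hB : Kolyvagin1990_padicValNat_card_sha_le N W K) (hK : IsImaginaryQuadratic K)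
    (hH : SatisfiesHeegnerHypothesis N K) {P : (W.baseChange K).toAffine.Point}
    (hP : IsHeegnerPoint N W K P) (hnt : ¬ IsOfFinAddOrder P)
    (hp2 : p ≠ 2) (hρ : W.HasSurjectiveModNGaloisRep p)
    (hI : padicValNat p (AddSubgroup.zmultiples P).index ≤ 1)
    (hr : W.analyticRank = 1) {s : ℚ} (hs : shaAn W = (s : ℂ)) (hv : padicValRat p s = 2)
    (W' : WeierstrassCurve ℚ) [W'.IsElliptic]
    (θ : geomTorsion W' (p : ℤ) ≃+ geomTorsion W (p : ℤ))
    (hθ : ∀ (σ : Field.absoluteGaloisGroup ℚ) (P : geomTorsion W' (p : ℤ)), θ (σ • P) = σ • θ P)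
    (hrank : 3 ≤ W'.mordellWeilRank) (S : Finset (HeightOneSpectrum (𝓞 ℚ)))
    (hS : ∀ v : HeightOneSpectrum (𝓞 ℚ), v ∉ S →
      W.HasGoodReductionAt v ∧ W'.HasGoodReductionAt v ∧ (p : 𝓞 ℚ) ∉ v.asIdeal)
    (hloc : ∀ v ∈ S, Nat.card (nsmulAddMonoidHom p :
      (W'.baseChange (v.adicCompletion ℚ)).toAffine.Point →+ _).ker = 1) :
    BSDp W p := by
  obtain ⟨hrk, hfin⟩ := hGZK W (by omega)
  haveI : NeZero (p : ℚ) := ⟨by exact_mod_cast (Fact.out : p.Prime).ne_zero⟩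
  have hirr : Irr W p := hasIrreducibleModPGaloisRep_of_hasSurjectiveModNGaloisRep W p hρ
  have hrank' : W.mordellWeilRank + Module.finrank ℚ ℚ + 1 ≤ W'.mordellWeilRank := by
    rw [hrk, hr, Module.finrank_self]; exact hrank
  -- LOWER half: a visible non-zero element of `Ш(E/ℚ)[p]` (no rational `p`-torsion since `E[p]` is
  -- irreducible, Mazur), then Cassels–Tate squareness
  have hdvd : p ∣ W.shaOrder :=
    dvd_shaOrder_of_exists_torsion W p
      (exists_sha_ne_zero_of_congr_of_rank_add W W' hp2 θ hθ S hS
        ((natCard_torsionBy_point_eq_of_subsingleton W _ _ _).trans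
          (natCard_torsionBy_eq_one_of_hasIrreducibleModPGaloisRep W p hirr)) hrank' hloc)
  have hlow : MissingLowerBoundAt W p :=
    missingLowerBoundAt_of_casselsTate_of_pow_dvd W p hCT hfin hs (k := 1)
      (by rw [hv]; norm_num) (by simpa using hdvd)
  -- UPPER half: Kolyvagin
  have hup : MissingUpperBoundAt W p :=
    missingUpperBoundAt_of_padicValNat_shaOrder_le W p (k := 1)
      (padicValNat_shaOrder_le_of_kolyvagin W p hKo hB hK hH hP hnt hp2 hρ hfin hI)
      hs (by rw [hv]; norm_num)
  exact bsdp_of_missingPPartAt W p hGZK (by omega) (missingPPartAt_of_lower_of_upper W p hlow hup)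

/-- **X11b at an odd `p` with `ρ̄_{E,p}` onto and `ord_p #Ш_an = 2`: `BSD(E,p)` from PUBLISHED theorems
(Kolyvagin via McCallum/Gross; Cassels–Tate; Gross–Zagier–Kolyvagin) plus the two per-pair certificates
of `bsdp_of_kolyvagin_of_congr`** — the cell's canonical class shape (`ClassX11b W p` supplies
`r_an = 1` and `p ≠ 2`; `Mult`, `Irr` are not even needed beyond `Surj`). Census (X11 ∧ `r = 1` ∧ ¬sst
∧ `p ≥ 5`, `N < 5·10⁵`, HOME/b2b-bsdres-x11c/RESISTANT.md §B): exactly ONE pair has `p ∣ #Ш_an`,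
`403280bd1@5` (`#Ш_an = 25`), with partner `403280a1` of rank `3` — `X11b/VisibilityPair403280bd1.lean`.
SUB-class statement; NOT a deletion of the class; the lane certifies pairs and owns verdicts.
[cite: McCallumLMS1991, §1 Theorem (Kolyvagin), p. 296] [cite: SilvermanAEC2009, Thm. X.4.14]
[cite: CremonaMazur2000, §3 and Table 1] [cite: Miller2011LMS, §1 and Def. 1.1] -/
theorem ClassX11b.bsdp_of_kolyvagin_of_congr (hCT : exists_casselsTate_pairing (K := ℚ))
    (hGZK : rank_eq_analyticRank_of_analyticRank_le_one) (hX : ClassX11b W p)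
    {N : ℕ} [NeZero N] {K : Type} [Field K] [NumberField K] (hKo : kolyvagin N W K)
    (hB : Kolyvagin1990_padicValNat_card_sha_le N W K) (hK : IsImaginaryQuadratic K)
    (hH : SatisfiesHeegnerHypothesis N K) {P : (W.baseChange K).toAffine.Point}
    (hP : IsHeegnerPoint N W K P) (hnt : ¬ IsOfFinAddOrder P) (hρ : Surj W p)
    (hI : padicValNat p (AddSubgroup.zmultiples P).index ≤ 1)
    {s : ℚ} (hs : shaAn W = (s : ℂ)) (hv : padicValRat p s = 2)
    (W' : WeierstrassCurve ℚ) [W'.IsElliptic]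
    (θ : geomTorsion W' (p : ℤ) ≃+ geomTorsion W (p : ℤ))
    (hθ : ∀ (σ : Field.absoluteGaloisGroup ℚ) (P : geomTorsion W' (p : ℤ)), θ (σ • P) = σ • θ P)
    (hrank : 3 ≤ W'.mordellWeilRank) (S : Finset (HeightOneSpectrum (𝓞 ℚ)))
    (hS : ∀ v : HeightOneSpectrum (𝓞 ℚ), v ∉ S →
      W.HasGoodReductionAt v ∧ W'.HasGoodReductionAt v ∧ (p : 𝓞 ℚ) ∉ v.asIdeal)
    (hloc : ∀ v ∈ S, Nat.card (nsmulAddMonoidHom p :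
      (W'.baseChange (v.adicCompletion ℚ)).toAffine.Point →+ _).ker = 1) :
    BSDp W p :=
  -- (fully qualified: inside `ClassX11b.…` the short name would resolve to this very declaration)
  _root_.Summit.BirchSwinnertonDyer.Rank1Residual.X11b.bsdp_of_kolyvagin_of_congr W p hCT hGZK hKo hB
    hK hH hP hnt hX.2.1 hρ hI hX.1 hs hv W' θ hθ hrank S hS hloc

end Assembly

end Summit.BirchSwinnertonDyer.Rank1Residual.X11b

end
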